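import Literature.Geometry.Lorentzian.CutBondiMass
import Literature.Geometry.Lorentzian.HypersurfaceNaturality
import Literature.Geometry.Lorentzian.IsometricImmersionExp
import Literature.Geometry.Lorentzian.ConvergenceTransport
import Literature.Geometry.Lorentzian.CauchyDevelopmentIsometryClasses
import Literature.Topology.FourManifolds.ImmersionCriterion
import HarnessLib

/-!
# Route BondiDrainDispersal · crux `HorizonlessMustDrain` (stmt-FinalStateConjecture-9976), line `birth`,
# stub S6 `stub_hasVanishingFinalBondiMass_transport`: vanishing final Bondi mass is invariant under
# isometry of developments

Helper file of the line `birth` of `Theses.BondiDrainDispersal.HorizonlessMustDrain`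
(`--supports stmt-FinalStateConjecture-9976`).  For Cauchy developments `𝒟₁`, `𝒟₂` of one datum which
are isometric as developments (`CauchyDevelopment.IsIsometricTo`: a time-orientation preserving isometric
diffeomorphism `ψ : M₁ ≃ M₂` with `ψ ∘ ι₁ = ι₂`), a round receding family of sections of `∂J⁺(K)` in `𝒟₁`
(`CauchyDevelopment.RoundSectionFamily`, `CutBondiMass.lean`) is pushed forward along `ψ` to one of
`∂J⁺(ψ K)` in `𝒟₂` with THE SAME Hawking masses, so that `CauchyDevelopment.HasVanishingFinalBondiMass`
passes from `𝒟₁` to `𝒟₂` (`stub_hasVanishingFinalBondiMass_transport`, the registered stub, last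
declaration): `ψ(∂J⁺(S)) = ∂J⁺(ψ S)` (`image_frontier_causalFuture_eq`); `(ψ ∘ f)^* g₂ = f^* g₁`, hence equal
areas and Gauss curvatures (`surfaceArea_comp`, `gaussCurvature_comp`); `ψ ∘ f` is again a smooth spacelike
embedding (`isSmoothEmbedding_comp`); the null expansions of `ψ ∘ f` w.r.t. `dψ L` are those of `f` w.r.t. `L`
(`nullExpansion_comp`: naturality of the mean curvature under local isometries, `meanCurvature_comap`, with
`g₁ = ψ^* g₂`), so the Hawking masses w.r.t. `(dψ L, dψ L̲)` agree (`hawkingMass_comp`); generator geodesics go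
to generator geodesics (`tangent_transport`).  Everything is proved; no named fact is introduced or consumed.
References: Choquet-Bruhat–Geroch, Comm. Math. Phys. 14 (1969) 329–335; O'Neill, *Semi-Riemannian geometry*
(1983), Ch. 3, pp. 58, 90–91, Prop. 3.59, Ch. 4, Lemma 4.4, Ch. 14, p. 402; Christodoulou–Klainerman (1993),
Ch. 17, (17.0.2).
-/

set_option linter.dupNamespace false

noncomputable section

open scoped Manifold ContDiff Topology
open Set Filter Bundle Function MeasureTheory

namespace Summit.FinalStateConjecture.FinalStateConjecture.Theorems.BondiDrainDispersalHorizonlessMustDrain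

open Literature.Geometry.Lorentzian

namespace StubHasVanishingFinalBondiMassTransport

section Generic

variable {E : Type*} [NormedAddCommGroup E] [NormedSpace ℝ E] {H : Type*} [TopologicalSpace H]
  {I : ModelWithCorners ℝ E H} {M : Type*} [TopologicalSpace M] [ChartedSpace H M] [IsManifold I ∞ M]
  {E' : Type*} [NormedAddCommGroup E'] [NormedSpace ℝ E'] {H' : Type*} [TopologicalSpace H']
  {I' : ModelWithCorners ℝ E' H'} {N : Type*} [TopologicalSpace N] [ChartedSpace H' N]
  [IsManifold I' ∞ N] [FiniteDimensional ℝ E] [FiniteDimensional ℝ E'] [CompleteSpace E']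
  {E'' : Type*} [NormedAddCommGroup E''] [NormedSpace ℝ E''] {H'' : Type*} [TopologicalSpace H'']
  {I'' : ModelWithCorners ℝ E'' H''} {P : Type*} [TopologicalSpace P] [ChartedSpace H'' P]
  [IsManifold I'' ∞ P] [FiniteDimensional ℝ E'']

/-- **Naturality of the mean curvature, for a metric EQUAL to a pullback metric**: if `G = Φ^* g`
(`PseudoRiemannianMetric.comap`) for a smooth equidimensional immersion `Φ : N → M`, then
`H^{G}_{f, ν}(y) = H^{g}_{Φ ∘ f, dΦ ν}(y)` (`meanCurvature_comap` after substituting `G`; the standing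
Levi-Civita hypotheses are `Prop`s). [cite: ONeillSemiRiemannian1983, Ch. 3, Prop. 3.59 and Ch. 4, Lemma 4.4] -/
theorem meanCurvature_eq_of_eq_comap
    (g : PseudoRiemannianMetric I ∞ E (TangentSpace I : M → Type _)) [g.HasLeviCivita]
    {Φ : N → M} (hΦ : ContMDiff I' I (∞ + 1) Φ) (hΦ' : ∀ u, Injective (mfderiv I' I Φ u))
    (hdim : Module.finrank ℝ E' = Module.finrank ℝ E)
    {G : PseudoRiemannianMetric I' ∞ E' (TangentSpace I' : N → Type _)} [G.HasLeviCivita]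
    (hG : G = g.comap PseudoRiemannianMetric.contMDiff_pullbackBilin_holds Φ hΦ hΦ' hdim)
    {f : P → N} (hf : G.IsSpacelikeImmersion I'' f) (hΦf : g.IsSpacelikeImmersion I'' (Φ ∘ f))
    {ν : NormalField I' f} {y : P} (hy : I''.IsInteriorPoint y)
    (hν : MDifferentiableAt I'' I'.tangent
      (fun y ↦ (TotalSpace.mk' E' (f y) (ν y) : TangentBundle I' N)) y) :
    G.meanCurvature f PseudoRiemannianMetric.contMDiff_pullbackBilin_holds hf ν y =
      g.meanCurvature (Φ ∘ f) PseudoRiemannianMetric.contMDiff_pullbackBilin_holds hΦf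
        (fun y ↦ mfderiv I' I Φ (f y) (ν y)) y := by
  subst hG
  exact g.meanCurvature_comap _ hΦ hΦ' hdim _ _ hf hΦf hy hν

end Generic

variable {X : Type*} [TopologicalSpace X] [ChartedSpace E3 X] [IsManifold (𝓡 3) ∞ X]
  [ConnectedSpace X] {D : InitialDataSet (𝓡 3) X} {𝒟₁ 𝒟₂ : CauchyDevelopment D}
  (ψ : Diffeomorph (𝓡 (3 + 1)) (𝓡 (3 + 1)) 𝒟₁.carrier 𝒟₂.carrier ∞)
  (hiso : 𝒟₁.metric.IsIsometry 𝒟₂.metric.toPseudoRiemannianMetric ψ)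
  (hτ : 𝒟₁.timeOrientation.PreservesTimeOrientation ψ 𝒟₂.timeOrientation)

/-- A diffeomorphism is differentiable. [folklore] -/
theorem mdifferentiable : MDifferentiable (𝓡 (3 + 1)) (𝓡 (3 + 1)) ψ :=
  ψ.contMDiff.mdifferentiable (by simp)

include hiso in
/-- `g₂(dψ u, dψ w) = g₁(u, w)` (the isometry identity, pointwise). [cite: ONeillSemiRiemannian1983, Ch. 3, p. 58] -/
theorem val_mfderiv_mfderiv (y : 𝒟₁.carrier) (u w : TangentSpace (𝓡 (3 + 1)) y) :
    𝒟₂.metric.val (ψ y) (mfderiv (𝓡 (3 + 1)) (𝓡 (3 + 1)) ψ y u)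
        (mfderiv (𝓡 (3 + 1)) (𝓡 (3 + 1)) ψ y w) = 𝒟₁.metric.val y u w := by
  simpa only [pullbackBilin_apply] using congrArg (fun b ↦ b u w) (hiso y)

include hiso in
/-- An isometry is an isometric immersion. [cite: ONeillSemiRiemannian1983, Ch. 3, p. 58] -/
theorem isIsometricImmersion :
    𝒟₁.metric.IsIsometricImmersion 𝒟₂.metric.toPseudoRiemannianMetric ψ :=
  ⟨ψ.contMDiff, hiso⟩

include hiso in
/-- `g₁ = ψ^* g₂` as pseudo-Riemannian metrics. [cite: ONeillSemiRiemannian1983, Ch. 3, pp. 90–91] -/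
theorem eq_comap :
    𝒟₁.metric.toPseudoRiemannianMetric =
      𝒟₂.metric.toPseudoRiemannianMetric.comap PseudoRiemannianMetric.contMDiff_pullbackBilin_holds ψ
        (isIsometricImmersion ψ hiso).contMDiff_add_one (isIsometricImmersion ψ hiso).injective_mfderiv
        rfl :=
  (isIsometricImmersion ψ hiso).eq_comap rfl _ _

include hiso in
/-- The inverse of an isometric diffeomorphism is isometric, `(ψ⁻¹)^* g₁ = g₂`. [cite: ONeillSemiRiemannian1983, Ch. 3, p. 58] -/
theorem isIsometry_symm : 𝒟₂.metric.IsIsometry 𝒟₁.metric.toPseudoRiemannianMetric ψ.symm := by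
  -- adapted from `DataEmbedding.IsIsometricTo.symm` (CauchyDevelopmentIsometryClasses)
  intro z
  have h1 : 𝒟₁.metric.val =
      pullbackBilin (I := 𝓡 (3 + 1)) (I' := 𝓡 (3 + 1)) ψ 𝒟₂.metric.val := (funext hiso).symm
  rw [h1, ← pullbackBilin_comp (mdifferentiable ψ) (mdifferentiable ψ.symm),
    show (ψ : 𝒟₁.carrier → 𝒟₂.carrier) ∘ ψ.symm = id from funext ψ.apply_symm_apply, pullbackBilin_id]

include hiso hτ in
/-- The inverse of a time-orientation preserving isometric diffeomorphism preserves the time orientations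
(`dψ (dψ⁻¹ T₂) = T₂` is future-directed, `dψ` reflects future-directedness). [cite: ONeillSemiRiemannian1983, Ch. 5, p. 145] -/
theorem preservesTimeOrientation_symm :
    𝒟₂.timeOrientation.PreservesTimeOrientation ψ.symm 𝒟₁.timeOrientation := by
  -- adapted from `DataEmbedding.IsIsometricTo.symm` (CauchyDevelopmentIsometryClasses)
  intro z
  have h := mfderiv_comp z (mdifferentiable ψ (ψ.symm z)) (mdifferentiable ψ.symm z)
  rw [show (ψ : 𝒟₁.carrier → 𝒟₂.carrier) ∘ ψ.symm = id from funext ψ.apply_symm_apply,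
    mfderiv_id] at h
  refine hτ.isFutureDirected_of_mfderiv hiso ?_
  rw [← ContinuousLinearMap.comp_apply, ← h, ψ.apply_symm_apply]
  exact 𝒟₂.timeOrientation.isFutureDirected_vectorField z

include hiso hτ in
/-- **Achronal boundaries are transported**, `ψ(∂J⁺(S)) = ∂J⁺(ψ(S))`: `ψ` and `ψ⁻¹` carry future causal
curves to future causal curves (`LorentzianMetric.image_causalFuture_subset`), so `ψ(J⁺(S)) = J⁺(ψ(S))`, and
homeomorphisms map frontiers to frontiers. [cite: ONeillSemiRiemannian1983, Ch. 14, pp. 402–403] -/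
theorem image_frontier_causalFuture_eq (S : Set 𝒟₁.carrier) :
    ψ '' frontier (𝒟₁.metric.causalFuture 𝒟₁.timeOrientation S) =
      frontier (𝒟₂.metric.causalFuture 𝒟₂.timeOrientation (ψ '' S)) := by
  have hJ : ψ '' 𝒟₁.metric.causalFuture 𝒟₁.timeOrientation S =
      𝒟₂.metric.causalFuture 𝒟₂.timeOrientation (ψ '' S) := by
    refine Subset.antisymm
      (LorentzianMetric.image_causalFuture_subset (mdifferentiable ψ) hτ hiso S) fun q hq ↦ ?_
    have h := LorentzianMetric.image_causalFuture_subset (mdifferentiable ψ.symm)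
      (preservesTimeOrientation_symm ψ hiso hτ) (isIsometry_symm ψ hiso) (ψ '' S)
      (mem_image_of_mem ψ.symm hq)
    rw [ψ.symm_image_image] at h
    exact ⟨ψ.symm q, h, ψ.apply_symm_apply q⟩
  rw [← hJ]
  exact ψ.toHomeomorph.image_frontier _

variable {f : Metric.sphere (0 : E3) 1 → 𝒟₁.carrier}

/-- Chain rule `d(ψ ∘ f) v = dψ (df v)`. [folklore] -/
theorem mfderiv_comp_apply {y : Metric.sphere (0 : E3) 1}
    (hf : MDifferentiableAt (𝓡 2) (𝓡 (3 + 1)) f y) (v : TangentSpace (𝓡 2) y) :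
    mfderiv (𝓡 2) (𝓡 (3 + 1)) (ψ ∘ f) y v =
      mfderiv (𝓡 (3 + 1)) (𝓡 (3 + 1)) ψ (f y) (mfderiv (𝓡 2) (𝓡 (3 + 1)) f y v) := by
  rw [mfderiv_comp y (mdifferentiable ψ (f y)) hf]; rfl

include hiso in
/-- **The induced forms agree**, `(ψ ∘ f)^* g₂ = f^* g₁` (chain rule). [cite: ONeillSemiRiemannian1983, Ch. 3, p. 58] -/
theorem inducedBilin_comp {y : Metric.sphere (0 : E3) 1}
    (hf : MDifferentiableAt (𝓡 2) (𝓡 (3 + 1)) f y) :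
    𝒟₂.metric.inducedBilin (𝓡 2) (ψ ∘ f) y = 𝒟₁.metric.inducedBilin (𝓡 2) f y := by
  ext v w
  rw [PseudoRiemannianMetric.inducedBilin_apply, PseudoRiemannianMetric.inducedBilin_apply,
    mfderiv_comp_apply ψ hf, mfderiv_comp_apply ψ hf]
  exact val_mfderiv_mfderiv ψ hiso (f y) _ _

include hiso in
/-- **Spacelike immersions go to spacelike immersions.** [cite: ONeillSemiRiemannian1983, Ch. 4, p. 97] -/
theorem isSpacelikeImmersion_comp (hf : 𝒟₁.metric.IsSpacelikeImmersion (𝓡 2) f) :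
    𝒟₂.metric.IsSpacelikeImmersion (𝓡 2) (ψ ∘ f) := by
  refine ⟨(isIsometricImmersion ψ hiso).contMDiff_add_one.comp hf.contMDiff, fun y v hv ↦ ?_⟩
  rw [inducedBilin_comp ψ hiso ((hf.contMDiff_self y).mdifferentiableAt (by simp))]
  exact hf.inducedBilin_pos y hv

/-- Two `C^n` Riemannian metrics on the sphere with the same inner products are equal. [folklore] -/
theorem contMDiffRiemannianMetric_ext
    {R₁ R₂ : ContMDiffRiemannianMetric (𝓡 2) ∞ (EuclideanSpace ℝ (Fin 2))
      (TangentSpace (𝓡 2) : Metric.sphere (0 : E3) 1 → Type _)}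
    (h : R₁.inner = R₂.inner) : R₁ = R₂ := by
  cases R₁; cases R₂; cases h; rfl

include hiso in
/-- **The induced Riemannian metrics agree**, `(ψ ∘ f)^* g₂ = f^* g₁`. [cite: ONeillSemiRiemannian1983, Ch. 3, p. 58] -/
theorem inducedRiemannianMetric_comp (hf : 𝒟₁.metric.IsSpacelikeImmersion (𝓡 2) f) :
    𝒟₂.metric.inducedRiemannianMetric (ψ ∘ f) PseudoRiemannianMetric.contMDiff_pullbackBilin_holds
        (isSpacelikeImmersion_comp ψ hiso hf) =
      𝒟₁.metric.inducedRiemannianMetric f PseudoRiemannianMetric.contMDiff_pullbackBilin_holds hf :=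
  contMDiffRiemannianMetric_ext (funext fun y ↦
    inducedBilin_comp ψ hiso ((hf.contMDiff_self y).mdifferentiableAt (by simp)))

include hiso in
/-- **The areas agree**, `|ψ ∘ f| = |f|`. [cite: ChristodoulouKlainerman1993PMS41, Ch. 17, (17.0.2)] -/
theorem surfaceArea_comp (hf : 𝒟₁.metric.IsSpacelikeImmersion (𝓡 2) f) :
    𝒟₂.metric.surfaceArea (ψ ∘ f) (isSpacelikeImmersion_comp ψ hiso hf) =
      𝒟₁.metric.surfaceArea f hf := by
  unfold LorentzianMetric.surfaceArea; rw [inducedRiemannianMetric_comp ψ hiso hf]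

/-- The scalar curvature of a Riemannian metric `R` on the sphere read as a pseudo-Riemannian metric
(`ofRiemannian`, Levi-Civita instance `hasLeviCivita`) only depends on `R`. [folklore] -/
theorem scalarCurvature_ofRiemannian_congr
    {R₁ R₂ : ContMDiffRiemannianMetric (𝓡 2) ∞ (EuclideanSpace ℝ (Fin 2))
      (TangentSpace (𝓡 2) : Metric.sphere (0 : E3) 1 → Type _)}
    (h : R₁ = R₂) (y : Metric.sphere (0 : E3) 1) :
    (haveI := (PseudoRiemannianMetric.ofRiemannian R₁).hasLeviCivita
     (PseudoRiemannianMetric.ofRiemannian R₁).scalarCurvature y) =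
      (haveI := (PseudoRiemannianMetric.ofRiemannian R₂).hasLeviCivita
       (PseudoRiemannianMetric.ofRiemannian R₂).scalarCurvature y) := by
  subst h; rfl

include hiso in
/-- **The Gauss curvatures agree**, `K_{ψ ∘ f} = K_f`. [cite: ChristodoulouKlainerman1993PMS41, Ch. 17, proof of Conclusion 17.0.4] -/
theorem gaussCurvature_comp (hf : 𝒟₁.metric.IsSpacelikeImmersion (𝓡 2) f)
    (y : Metric.sphere (0 : E3) 1) :
    𝒟₂.metric.gaussCurvature (ψ ∘ f) (isSpacelikeImmersion_comp ψ hiso hf) y =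
      𝒟₁.metric.gaussCurvature f hf y :=
  congrArg (fun r : ℝ ↦ r / 2)
    (scalarCurvature_ofRiemannian_congr (inducedRiemannianMetric_comp ψ hiso hf) y)

include hiso in
/-- **Smooth embeddings of the sphere go to smooth embeddings** (`ψ ∘ f` is smooth, injective, with
injective differential, on a compact source). [cite: HirschDT1976, Ch. 1 §3 Thm. 3.1] -/
theorem isSmoothEmbedding_comp (he : Manifold.IsSmoothEmbedding (𝓡 2) (𝓡 (3 + 1)) ∞ f)
    (hf : 𝒟₁.metric.IsSpacelikeImmersion (𝓡 2) f) :
    Manifold.IsSmoothEmbedding (𝓡 2) (𝓡 (3 + 1)) ∞ (ψ ∘ f) := by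
  refine Literature.Topology.FourManifolds.isSmoothEmbedding_of_injective_of_injective_mfderiv
    (ψ.contMDiff.comp he.contMDiff) (by simp) ((EquivLike.injective ψ).comp he.isEmbedding.injective)
    fun y v w hvw ↦ ?_
  have hfd : MDifferentiableAt (𝓡 2) (𝓡 (3 + 1)) f y := (hf.contMDiff_self y).mdifferentiableAt (by simp)
  rw [mfderiv_comp_apply ψ hfd, mfderiv_comp_apply ψ hfd] at hvw
  exact hf.injective_mfderiv y ((isIsometricImmersion ψ hiso).injective_mfderiv (f y) hvw)

include hiso in
/-- **The null expansions agree**, `θ^{g₂}_{ψ ∘ f, dψ L}(y) = θ^{g₁}_{f, L}(y)` for a field `L` along `f`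
differentiable at `y` (null expansion = mean curvature; naturality of the mean curvature under the local
isometry `ψ : (M₁, g₁ = ψ^* g₂) → (M₂, g₂)`). [cite: ONeillSemiRiemannian1983, Ch. 3, Prop. 3.59 and Ch. 4, Lemma 4.4] -/
theorem nullExpansion_comp [𝒟₁.metric.HasLeviCivita] [𝒟₂.metric.HasLeviCivita]
    (hf : 𝒟₁.metric.IsSpacelikeImmersion (𝓡 2) f) {L : NormalField (𝓡 (3 + 1)) f}
    {y : Metric.sphere (0 : E3) 1}
    (hL : MDifferentiableAt (𝓡 2) (𝓡 (3 + 1)).tangent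
      (fun y ↦ (TotalSpace.mk' (EuclideanSpace ℝ (Fin (3 + 1))) (f y) (L y) :
        TangentBundle (𝓡 (3 + 1)) 𝒟₁.carrier)) y) :
    𝒟₂.metric.nullExpansion (ψ ∘ f) PseudoRiemannianMetric.contMDiff_pullbackBilin_holds
        (isSpacelikeImmersion_comp ψ hiso hf)
        (fun y ↦ mfderiv (𝓡 (3 + 1)) (𝓡 (3 + 1)) ψ (f y) (L y)) y =
      𝒟₁.metric.nullExpansion f PseudoRiemannianMetric.contMDiff_pullbackBilin_holds hf L y := by
  rw [LorentzianMetric.nullExpansion_eq_meanCurvature, LorentzianMetric.nullExpansion_eq_meanCurvature]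
  exact (meanCurvature_eq_of_eq_comap 𝒟₂.metric.toPseudoRiemannianMetric
    (isIsometricImmersion ψ hiso).contMDiff_add_one (isIsometricImmersion ψ hiso).injective_mfderiv rfl
    (eq_comap ψ hiso) hf (isSpacelikeImmersion_comp ψ hiso hf) BoundarylessManifold.isInteriorPoint
    hL).symm

include hiso in
/-- **Normal fields go to normal fields**, `dψ ν ⊥ d(ψ ∘ f)`. [cite: ONeillSemiRiemannian1983, Ch. 4, p. 98] -/
theorem isNormalTo_comp (hfd : ∀ y, MDifferentiableAt (𝓡 2) (𝓡 (3 + 1)) f y)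
    {ν : NormalField (𝓡 (3 + 1)) f} (hν : 𝒟₁.metric.IsNormalTo (𝓡 2) f ν) :
    𝒟₂.metric.IsNormalTo (𝓡 2) (ψ ∘ f)
      (fun y ↦ mfderiv (𝓡 (3 + 1)) (𝓡 (3 + 1)) ψ (f y) (ν y)) := by
  intro y v
  rw [mfderiv_comp_apply ψ (hfd y), ← hν y v]
  exact val_mfderiv_mfderiv ψ hiso (f y) _ _

include hiso in
/-- **Null vectors go to null vectors** (`dψ` is isometric and injective). [cite: ONeillSemiRiemannian1983, Ch. 3, p. 58] -/
theorem isNull_mfderiv {x : 𝒟₁.carrier} {v : TangentSpace (𝓡 (3 + 1)) x} (hv : 𝒟₁.metric.IsNull v) :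
    𝒟₂.metric.IsNull (mfderiv (𝓡 (3 + 1)) (𝓡 (3 + 1)) ψ x v) := by
  refine ⟨?_, fun h0 ↦ hv.2 ((isIsometricImmersion ψ hiso).injective_mfderiv x (by rw [h0, map_zero]))⟩
  rw [← hv.1]
  exact val_mfderiv_mfderiv ψ hiso x v v

/-- **`C¹` fields along `f` go to `C¹` fields along `ψ ∘ f`**: the lift of `dψ ν` to `TM₂` is the tangent
map of `ψ` (a `C¹` map, `1 + 1 ≤ ∞`) composed with the lift of `ν`. [folklore] -/
theorem contMDiff_lift_mfderiv {ν : NormalField (𝓡 (3 + 1)) f}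
    (hν : ContMDiff (𝓡 2) (𝓡 (3 + 1)).tangent 1
      (fun y ↦ (TotalSpace.mk' (EuclideanSpace ℝ (Fin (3 + 1))) (f y) (ν y) :
        TangentBundle (𝓡 (3 + 1)) 𝒟₁.carrier))) :
    ContMDiff (𝓡 2) (𝓡 (3 + 1)).tangent 1
      (fun y ↦ (TotalSpace.mk' (EuclideanSpace ℝ (Fin (3 + 1))) ((ψ ∘ f) y)
        (mfderiv (𝓡 (3 + 1)) (𝓡 (3 + 1)) ψ (f y) (ν y)) : TangentBundle (𝓡 (3 + 1)) 𝒟₂.carrier)) := by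
  exact (ψ.contMDiff.contMDiff_tangentMap
    (by rw [one_add_one_eq_two]; exact WithTop.coe_le_coe.mpr le_top)).comp hν

include hiso in
/-- **The Hawking masses agree**: if the null normal pair `P'` of `ψ ∘ f` is `(dψ L, dψ L̲)` for the null
normal pair `P = (L, L̲)` of `f`, then `m_H(ψ ∘ f; P') = m_H(f; P)` (equal induced Riemannian metrics, hence
areas and area measures, and equal null expansions). [cite: ChristodoulouKlainerman1993PMS41, Ch. 17, (17.0.2)] -/
theorem hawkingMass_comp [𝒟₁.metric.HasLeviCivita] [𝒟₂.metric.HasLeviCivita]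
    (hf : 𝒟₁.metric.IsSpacelikeImmersion (𝓡 2) f)
    (P : LorentzianMetric.NullNormalPair (𝓡 2) 𝒟₁.metric 𝒟₁.timeOrientation f)
    (P' : LorentzianMetric.NullNormalPair (𝓡 2) 𝒟₂.metric 𝒟₂.timeOrientation (ψ ∘ f))
    (hL : P'.L = fun y ↦ mfderiv (𝓡 (3 + 1)) (𝓡 (3 + 1)) ψ (f y) (P.L y))
    (hLbar : P'.Lbar = fun y ↦ mfderiv (𝓡 (3 + 1)) (𝓡 (3 + 1)) ψ (f y) (P.Lbar y)) :
    𝒟₂.metric.hawkingMass (ψ ∘ f) PseudoRiemannianMetric.contMDiff_pullbackBilin_holds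
        (isSpacelikeImmersion_comp ψ hiso hf) P' =
      𝒟₁.metric.hawkingMass f PseudoRiemannianMetric.contMDiff_pullbackBilin_holds hf P := by
  have hθL : ∀ y, 𝒟₂.metric.nullExpansion (ψ ∘ f) PseudoRiemannianMetric.contMDiff_pullbackBilin_holds
      (isSpacelikeImmersion_comp ψ hiso hf) P'.L y =
        𝒟₁.metric.nullExpansion f PseudoRiemannianMetric.contMDiff_pullbackBilin_holds hf P.L y :=
    fun y ↦ by rw [hL]; exact nullExpansion_comp ψ hiso hf ((P.contMDiff_L y).mdifferentiableAt one_ne_zero)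
  have hθLbar : ∀ y, 𝒟₂.metric.nullExpansion (ψ ∘ f)
      PseudoRiemannianMetric.contMDiff_pullbackBilin_holds (isSpacelikeImmersion_comp ψ hiso hf) P'.Lbar y =
        𝒟₁.metric.nullExpansion f PseudoRiemannianMetric.contMDiff_pullbackBilin_holds hf P.Lbar y :=
    fun y ↦ by
      rw [hLbar]; exact nullExpansion_comp ψ hiso hf ((P.contMDiff_Lbar y).mdifferentiableAt one_ne_zero)
  unfold LorentzianMetric.hawkingMass
  rw [inducedRiemannianMetric_comp ψ hiso hf]
  simp only [hθL, hθLbar]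

include hiso hτ in
/-- **Generator geodesics go to generator geodesics**: if the geodesic `γ` with initial data `(x, L)` runs
inside `∂J⁺(K)` for small positive affine parameter, then `ψ ∘ γ` is a geodesic with initial data `(ψ x, dψ L)`
(`IsIsometricImmersion.isGeodesicOn_comp`) running inside `ψ(∂J⁺(K)) = ∂J⁺(ψ K)`. [cite: ONeillSemiRiemannian1983, Ch. 3, pp. 90–91 and Prop. 3.59] -/
theorem tangent_transport {K : Set 𝒟₁.carrier} {x : 𝒟₁.carrier} {L : TangentSpace (𝓡 (3 + 1)) x}
    (h : ∃ (γ : ℝ → 𝒟₁.carrier) (ε : ℝ), 0 < ε ∧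
      IsGeodesicOn
        (haveI := 𝒟₁.metric.toPseudoRiemannianMetric.hasLeviCivita; 𝒟₁.metric.leviCivita)
        γ (Ioo (-ε) ε) ∧ γ 0 = x ∧
      velocity (𝓡 (3 + 1)) γ 0 = L ∧
      ∀ t ∈ Ioo 0 ε, γ t ∈ frontier (𝒟₁.metric.causalFuture 𝒟₁.timeOrientation K)) :
    ∃ (γ : ℝ → 𝒟₂.carrier) (ε : ℝ), 0 < ε ∧
      IsGeodesicOn
        (haveI := 𝒟₂.metric.toPseudoRiemannianMetric.hasLeviCivita; 𝒟₂.metric.leviCivita)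
        γ (Ioo (-ε) ε) ∧ γ 0 = ψ x ∧
      velocity (𝓡 (3 + 1)) γ 0 = mfderiv (𝓡 (3 + 1)) (𝓡 (3 + 1)) ψ x L ∧
      ∀ t ∈ Ioo 0 ε, γ t ∈ frontier (𝒟₂.metric.causalFuture 𝒟₂.timeOrientation (ψ '' K)) := by
  haveI := 𝒟₁.metric.toPseudoRiemannianMetric.hasLeviCivita
  haveI := 𝒟₂.metric.toPseudoRiemannianMetric.hasLeviCivita
  obtain ⟨γ, ε, hε, hgeo, hγ0, hvel, hfr⟩ := h
  obtain ⟨hgeo₂, hvel₂⟩ := (isIsometricImmersion ψ hiso).isGeodesicOn_comp rfl isOpen_Ioo hgeo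
  refine ⟨ψ ∘ γ, ε, hε, hgeo₂, ?_, ?_, fun t ht ↦ ?_⟩
  · show ψ (γ 0) = ψ x; rw [hγ0]
  · rw [hvel₂ 0 ⟨neg_lt_zero.2 hε, hε⟩]; subst hγ0; rw [hvel]
  · rw [← image_frontier_causalFuture_eq ψ hiso hτ K]
    exact mem_image_of_mem ψ (hfr t ht)

end StubHasVanishingFinalBondiMassTransport

open StubHasVanishingFinalBondiMassTransport

/-- **S6 — VANISHING FINAL BONDI MASS IS INVARIANT UNDER ISOMETRY OF DEVELOPMENTS.** If `𝒟₁`, `𝒟₂` are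
Cauchy developments of the same datum, isometric as developments (a time-orientation preserving isometric
diffeomorphism `ψ : M₁ ≃ M₂` with `ψ ∘ ι₁ = ι₂`, `CauchyDevelopment.IsIsometricTo`), and `𝒟₁` has vanishing
final Bondi mass, so has `𝒟₂`: for `ε > 0`, the compact `K ⊆ M₁` and the round receding family `𝓕` on
`∂J⁺(K)` with Hawking masses eventually `≤ ε` are pushed forward along `ψ` to the compact `ψ K` and the family
`ψ ∘ 𝓕.sec s` on `∂J⁺(ψ K)` with null normal pairs `(dψ L, dψ L̲)` — smooth, spacelike, `dψ L` tangent to the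
generators, with the same areas, Gauss curvatures and Hawking masses.  Choquet-Bruhat–Geroch 1969 (N1 is a
property of the isometry class); O'Neill 1983, Ch. 3, Prop. 3.59 ff. [cite: ONeillSemiRiemannian1983, Ch. 3, Prop. 3.59] -/
theorem stub_hasVanishingFinalBondiMass_transport : open scoped Manifold in
    ∀ {X : Type} [TopologicalSpace X] [ChartedSpace Literature.Geometry.Lorentzian.E3 X]
      [IsManifold (𝓡 3) ((⊤ : ℕ∞) : WithTop ℕ∞) X] [ConnectedSpace X]
      {D : Literature.Geometry.Lorentzian.InitialDataSet (𝓡 3) X}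
      (𝒟₁ 𝒟₂ : Literature.Geometry.Lorentzian.CauchyDevelopment D),
      𝒟₁.IsIsometricTo 𝒟₂ → 𝒟₁.HasVanishingFinalBondiMass → 𝒟₂.HasVanishingFinalBondiMass := by
  intro X _ _ _ _ D 𝒟₁ 𝒟₂ hI h ε hε
  obtain ⟨ψ, hiso, hτ, -⟩ := hI
  obtain ⟨K, hK, 𝓕, h𝓕⟩ := h ε hε
  haveI := 𝒟₁.metric.toPseudoRiemannianMetric.hasLeviCivita
  haveI := 𝒟₂.metric.toPseudoRiemannianMetric.hasLeviCivita
  have hfd : ∀ s y, MDifferentiableAt (𝓡 2) (𝓡 (3 + 1)) (𝓕.sec s) y := fun s y ↦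
    ((𝓕.isSpacelike s).contMDiff_self y).mdifferentiableAt (by simp)
  let P' (s : ℝ) : LorentzianMetric.NullNormalPair (𝓡 2) 𝒟₂.metric 𝒟₂.timeOrientation
      (ψ ∘ 𝓕.sec s) :=
    { L := fun y ↦ mfderiv (𝓡 (3 + 1)) (𝓡 (3 + 1)) ψ (𝓕.sec s y) ((𝓕.pair s).L y)
      Lbar := fun y ↦ mfderiv (𝓡 (3 + 1)) (𝓡 (3 + 1)) ψ (𝓕.sec s y) ((𝓕.pair s).Lbar y)
      isNormalTo_L := isNormalTo_comp ψ hiso (hfd s) (𝓕.pair s).isNormalTo_L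
      isNormalTo_Lbar := isNormalTo_comp ψ hiso (hfd s) (𝓕.pair s).isNormalTo_Lbar
      isNull_L := fun y ↦ isNull_mfderiv ψ hiso ((𝓕.pair s).isNull_L y)
      isNull_Lbar := fun y ↦ isNull_mfderiv ψ hiso ((𝓕.pair s).isNull_Lbar y)
      isFutureDirected_L := fun y ↦ hτ.isFutureDirected_mfderiv hiso ((𝓕.pair s).isFutureDirected_L y)
      isFutureDirected_Lbar := fun y ↦ hτ.isFutureDirected_mfderiv hiso ((𝓕.pair s).isFutureDirected_Lbar y)
      val_L_Lbar := fun y ↦ by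
        rw [← (𝓕.pair s).val_L_Lbar y]; exact val_mfderiv_mfderiv ψ hiso (𝓕.sec s y) _ _
      contMDiff_L := contMDiff_lift_mfderiv ψ (𝓕.pair s).contMDiff_L
      contMDiff_Lbar := contMDiff_lift_mfderiv ψ (𝓕.pair s).contMDiff_Lbar }
  let 𝓕' : CauchyDevelopment.RoundSectionFamily 𝒟₂ (ψ '' K) :=
    { sec := fun s ↦ ψ ∘ 𝓕.sec s
      range_sec_subset := fun s ↦ by
        rw [range_comp, ← image_frontier_causalFuture_eq ψ hiso hτ K]
        exact image_mono (𝓕.range_sec_subset s)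
      isSmoothEmbedding := fun s ↦ isSmoothEmbedding_comp ψ hiso (𝓕.isSmoothEmbedding s) (𝓕.isSpacelike s)
      isSpacelike := fun s ↦ isSpacelikeImmersion_comp ψ hiso (𝓕.isSpacelike s)
      pair := P'
      tangent_L := fun s y ↦ tangent_transport ψ hiso hτ (𝓕.tangent_L s y)
      tendsto_area := 𝓕.tendsto_area.congr fun s ↦ (surfaceArea_comp ψ hiso (𝓕.isSpacelike s)).symm
      round := by
        refine (tendstoUniformly_congr (Eventually.of_forall fun s ↦ funext fun y ↦ ?_)).2 𝓕.round
        rw [gaussCurvature_comp ψ hiso (𝓕.isSpacelike s), surfaceArea_comp ψ hiso (𝓕.isSpacelike s)] }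
  have hm : ∀ s, 𝓕'.hawkingMass s = 𝓕.hawkingMass s := fun s ↦
    hawkingMass_comp ψ hiso (𝓕.isSpacelike s) (𝓕.pair s) (P' s) rfl rfl
  exact ⟨ψ '' K, hK.image ψ.continuous, 𝓕', h𝓕.mono fun s hs ↦ (hm s).le.trans hs⟩

end Summit.FinalStateConjecture.FinalStateConjecture.Theorems.BondiDrainDispersalHorizonlessMustDrain

end
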